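import Literature.Topology.Immersions.DoublePointsGenericity
import Literature.Topology.Immersions.ProjectionFieldBundle
import Mathlib.Analysis.Calculus.FDeriv.Bilinear
import HarnessLib

/-!
# Generic sections of a projection-field bundle are transverse to the zero section

Topic `Literature/Topology/Immersions`. For a rank-`k` bundle `E = E(P)` over `M` inside
`M × ℝᵐ` (`ProjectionFieldBundle.lean`) and any `C^∞` map `s₀ : M → ℝᵐ`, the projected
translates

  `s_c = P(s₀ + c)`,  `c ∈ ℝᵐ`

are `C^∞` sections of `E`, and **for Lebesgue-almost every `c` the section `s_c` is transverse
to the zero section**: at every zero `x` of `s_c` the fibre component of its differential,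
`v ↦ P_x (ds_c(x) v)`, is onto `E_x` (Hirsch, *Differential Topology* (1976), Ch. 3 §2,
Thm. 2.7 applied in the bundle charts; this is the standing "generic section" hypothesis of the
zero-counting definition of the Euler number, Milnor–Stasheff §9 / Bott–Tu §6, §11, and of
Kirby, *The Topology of 4-Manifolds* (1989), Ch. II, Ch. VI: `χ(ν)` as a signed count of zeros
of a section). Proof: over the good set of a base point `x₀` the bundle chart coordinate
`leftInv(A_x)` (`A_x = P_x ∘ B_{x₀}` the transported frame) turns `s_c` into a map to `ℝᵏ`
whose family `(x, c) ↦ leftInv(A_x) P_x(s₀ x + c)` is submersive in `c`; the parametric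
transversality theorem (`volume_setOf_not_surjective_mfderiv_slice_eq_zero`) gives a null set
of bad `c` per chart, countably many charts cover `M`, and at a zero the chart derivative is
`leftInv(A_x) ∘ P_x ∘ ds_c(x)` (product rule), injective on `E_x`.

* `ProjBundle.mfderiv_clm_apply_of_eq_zero` — product rule `d(g·f)_x v = g_x (df_x v)` at a zero
  of `f`;
* `ProjBundle.volume_setOf_not_transverse_section_eq_zero`, `ProjBundle.dense_setOf_transverse_section`.

Everything here is proved; no definitions, no named facts.

## References

* M. W. Hirsch, *Differential Topology*, GTM 33 (1976), Ch. 3 §2 Thm. 2.7; Ch. 5 §2 (Euler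
  number via zeros of sections). [HirschDT1976]
* R. C. Kirby, *The Topology of 4-Manifolds*, LNM 1374 (1989), Ch. II, Ch. VI. [Kirby1989]
-/

open scoped Manifold ContDiff Topology
open Set Function Module MeasureTheory

noncomputable section

universe u

namespace Literature.Topology.Immersions

/-- Local notation: `𝔼 n` is the model Euclidean space `EuclideanSpace ℝ (Fin n)`. -/
local notation "𝔼 " n:arg => EuclideanSpace ℝ (Fin n)

open Literature.Geometry.Manifold (dense_compl_of_volume_eq_zero)
open Literature.Topology.FourManifolds (leftInv leftInv_apply_self contDiffAt_leftInv)

namespace ProjBundle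

variable {n m k : ℕ} {M : Type u} [TopologicalSpace M] [ChartedSpace (𝔼 n) M]

/-! ### A product rule at a zero -/

/-- **Product rule at a zero**: for a `C¹` field of linear maps `g` and a `C¹` map `f` with
`f x = 0`, `d(y ↦ g_y (f y))_x v = g_x (df_x v)`. [folklore] -/
theorem mfderiv_clm_apply_of_eq_zero {k' : ℕ} {g : M → 𝔼 m →L[ℝ] 𝔼 k'} {f : M → 𝔼 m} {x : M}
    (hg : MDifferentiableAt (𝓡 n) 𝓘(ℝ, 𝔼 m →L[ℝ] 𝔼 k') g x)
    (hf : MDifferentiableAt (𝓡 n) (𝓡 m) f x) (h0 : f x = 0) (v : 𝔼 n) :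
    mfderiv (𝓡 n) (𝓡 k') (fun y => g y (f y)) x v = g x (mfderiv (𝓡 n) (𝓡 m) f x v) := by
  have hb := (isBoundedBilinearMap_apply (𝕜 := ℝ) (E := 𝔼 m) (F := 𝔼 k')).hasFDerivAt (g x, f x)
  have hpair : HasMFDerivAt (𝓡 n) 𝓘(ℝ, (𝔼 m →L[ℝ] 𝔼 k') × 𝔼 m) (fun y => (g y, f y)) x
      ((mfderiv (𝓡 n) 𝓘(ℝ, 𝔼 m →L[ℝ] 𝔼 k') g x).prod (mfderiv (𝓡 n) (𝓡 m) f x)) :=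
    ⟨hg.hasMFDerivAt.1.prodMk hf.hasMFDerivAt.1, hg.hasMFDerivAt.2.prodMk hf.hasMFDerivAt.2⟩
  have hcomp := HasMFDerivAt.comp x hb.hasMFDerivAt hpair
  have hfun : (fun y => g y (f y)) =
      (fun p : (𝔼 m →L[ℝ] 𝔼 k') × 𝔼 m => p.1 p.2) ∘ fun y => (g y, f y) := rfl
  rw [hfun, hcomp.mfderiv]
  show (isBoundedBilinearMap_apply (𝕜 := ℝ) (E := 𝔼 m) (F := 𝔼 k')).deriv (g x, f x)
    (mfderiv (𝓡 n) 𝓘(ℝ, 𝔼 m →L[ℝ] 𝔼 k') g x v, mfderiv (𝓡 n) (𝓡 m) f x v) = _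
  rw [IsBoundedBilinearMap.deriv_apply, h0, map_zero, add_zero]

/-! ### Generic sections -/

variable [T2Space M] [SecondCountableTopology M] [IsManifold (𝓡 n) ∞ M]

/-- **Almost every projected translate is a section transverse to the zero section.** For a
projection-field bundle `P` and a `C^∞` map `s₀ : M → ℝᵐ`, the set of `c ∈ ℝᵐ` for which the
section `s_c = P(s₀ + c)` has a zero `x` where `v ↦ P_x(ds_c(x) v)` is NOT onto the fibre `E_x`
is Lebesgue-null. [cite: HirschDT1976, Ch. 3 §2 Thm. 2.7] -/
theorem volume_setOf_not_transverse_section_eq_zero (P : ProjBundle n m k M) {s₀ : M → 𝔼 m}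
    (hs₀ : ContMDiff (𝓡 n) (𝓡 m) ∞ s₀) :
    volume {c : 𝔼 m | ∃ x : M, P.proj x (s₀ x + c) = 0 ∧ ∃ w ∈ P.fibre x, ∀ v : 𝔼 n,
      P.proj x (ediff n m (fun y => P.proj y (s₀ y + c)) x v) ≠ w} = 0 := by
  -- countably many good sets cover `M`
  obtain ⟨T, hTc, hT⟩ := TopologicalSpace.countable_cover_nhds
    (fun x₀ : M => (P.isOpen_goodSet x₀).mem_nhds (P.mem_goodSet_self x₀))
  -- the chart family over the good set of `x₀`
  let G : M → M × 𝔼 m → 𝔼 k := fun x₀ z =>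
    leftInv (P.frameAt x₀ z.1) (P.proj z.1 (s₀ z.1 + z.2))
  have hsec : ContMDiff ((𝓡 n).prod (𝓡 m)) (𝓡 m) ∞ fun z : M × 𝔼 m => P.proj z.1 (s₀ z.1 + z.2) :=
    (P.contMDiff_proj'.comp contMDiff_fst).clm_apply ((hs₀.comp contMDiff_fst).add contMDiff_snd)
  have hLc : ∀ x₀, ContMDiffOn (𝓡 n) 𝓘(ℝ, 𝔼 m →L[ℝ] 𝔼 k) ∞ (fun x => leftInv (P.frameAt x₀ x))
      (P.goodSet x₀) := by
    intro x₀ x hx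
    exact (ContDiffAt.comp_contMDiffAt (f := P.frameAt x₀) (x := x)
      (contDiffAt_leftInv hx.2) (P.contMDiff_frameAt x₀ x)).contMDiffWithinAt
  have hG : ∀ x₀, ContMDiffOn ((𝓡 n).prod (𝓡 m)) (𝓡 k) ∞ (G x₀) (P.goodSet x₀ ×ˢ univ) := fun x₀ =>
    ((hLc x₀).comp contMDiff_fst.contMDiffOn fun z hz => hz.1).clm_apply hsec.contMDiffOn
  have hW : ∀ x₀, IsOpen (P.goodSet x₀ ×ˢ (univ : Set (𝔼 m))) := fun x₀ =>
    (P.isOpen_goodSet x₀).prod isOpen_univ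
  have hGd : ∀ x₀, ∀ z ∈ P.goodSet x₀ ×ˢ (univ : Set (𝔼 m)),
      MDifferentiableAt ((𝓡 n).prod (𝓡 m)) (𝓡 k) (G x₀) z := fun x₀ z hz =>
    ((hG x₀).contMDiffAt ((hW x₀).mem_nhds hz)).mdifferentiableAt (by simp)
  -- the `leftInv` coordinate inverts the frame and factors through `P`
  have hLA : ∀ x₀, ∀ x ∈ P.goodSet x₀, ∀ u : 𝔼 k,
      leftInv (P.frameAt x₀ x) (P.frameAt x₀ x u) = u := fun x₀ x hx u =>
    leftInv_apply_self hx.2 u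
  have hLinj : ∀ x₀, ∀ x ∈ P.goodSet x₀, ∀ w₁ ∈ P.fibre x, ∀ w₂ ∈ P.fibre x,
      leftInv (P.frameAt x₀ x) w₁ = leftInv (P.frameAt x₀ x) w₂ → w₁ = w₂ := by
    intro x₀ x hx w₁ hw₁ w₂ hw₂ h
    rw [← P.range_frameAt_of_mem hx] at hw₁ hw₂
    obtain ⟨a₁, rfl⟩ := hw₁
    obtain ⟨a₂, rfl⟩ := hw₂
    change leftInv (P.frameAt x₀ x) (P.frameAt x₀ x a₁) =
      leftInv (P.frameAt x₀ x) (P.frameAt x₀ x a₂) at h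
    rw [hLA x₀ x hx, hLA x₀ x hx] at h
    rw [h]
  -- submersivity in `c`
  have hsurj : ∀ x₀, ∀ z ∈ P.goodSet x₀ ×ˢ (univ : Set (𝔼 m)),
      Surjective (mfderiv ((𝓡 n).prod (𝓡 m)) (𝓡 k) (G x₀) z) := by
    rintro x₀ ⟨x, c⟩ ⟨hx, -⟩ u
    refine ⟨(0, P.frameAt x₀ x u), ?_⟩
    rw [← mfderiv_slice_right_apply (hGd x₀ _ ⟨hx, mem_univ _⟩)]
    -- the slice is affine: `c ↦ L (P (s₀ x)) + (L ∘ P) c`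
    have hfun : (fun c' : 𝔼 m => G x₀ (x, c')) = fun c' =>
        leftInv (P.frameAt x₀ x) (P.proj x (s₀ x)) +
          ((leftInv (P.frameAt x₀ x)).comp (P.proj x)) c' := by
      funext c'
      show leftInv (P.frameAt x₀ x) (P.proj x (s₀ x + c')) = _
      rw [map_add, map_add]
      rfl
    show mfderiv (𝓡 m) (𝓡 k) (fun c' : 𝔼 m => G x₀ (x, c')) c (P.frameAt x₀ x u) = u
    rw [hfun, mfderiv_eq_fderiv, fderiv_const_add, ContinuousLinearMap.fderiv]
    show leftInv (P.frameAt x₀ x) (P.proj x (P.frameAt x₀ x u)) = u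
    have hfix : P.proj x (P.frameAt x₀ x u) = P.frameAt x₀ x u :=
      P.mem_fibre_iff.1 (P.frameAt_apply_mem x₀ x u)
    rw [hfix]
    exact hLA x₀ x hx u
  -- parametric transversality over each good set
  have hN : ∀ x₀, volume {c : 𝔼 m | ∃ x : M, (x, c) ∈ P.goodSet x₀ ×ˢ (univ : Set (𝔼 m)) ∧
      G x₀ (x, c) = 0 ∧ ¬ Surjective (mfderiv (𝓡 n) (𝓡 k) (fun x' => G x₀ (x', c)) x)} = 0 :=
    fun x₀ => volume_setOf_not_surjective_mfderiv_slice_eq_zero (hW x₀) (hG x₀) (hsurj x₀) 0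
  -- the bad set lies in the countable union
  refine measure_mono_null ?_ ((measure_biUnion_null_iff hTc).2 fun x₀ _ => hN x₀)
  rintro c ⟨x, hzero, w, hw, hbad⟩
  have hx : x ∈ ⋃ x₀ ∈ T, P.goodSet x₀ := by rw [hT]; trivial
  obtain ⟨x₀, hx₀T, hxg⟩ := mem_iUnion₂.1 hx
  refine mem_iUnion₂.2 ⟨x₀, hx₀T, x, ⟨hxg, mem_univ _⟩, ?_, fun hS => ?_⟩
  · show leftInv (P.frameAt x₀ x) (P.proj x (s₀ x + c)) = 0
    rw [hzero, map_zero]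
  · -- a regular point of the chart map is a transverse zero
    obtain ⟨v, hv⟩ := hS (leftInv (P.frameAt x₀ x) w)
    apply hbad v
    -- `d(G_c)_x v = leftInv(A_x) (d s_c(x) v) = leftInv(A_x) (P_x (d s_c(x) v))`
    have hsc : ContMDiff (𝓡 n) (𝓡 m) ∞ fun y => P.proj y (s₀ y + c) :=
      P.contMDiff_proj'.clm_apply (hs₀.add contMDiff_const)
    have hprod := mfderiv_clm_apply_of_eq_zero (g := fun y => leftInv (P.frameAt x₀ y))
      (f := fun y => P.proj y (s₀ y + c))
      (((hLc x₀).contMDiffAt ((P.isOpen_goodSet x₀).mem_nhds hxg)).mdifferentiableAt (by simp))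
      ((hsc x).mdifferentiableAt (by simp)) hzero v
    have hv' : leftInv (P.frameAt x₀ x) (ediff n m (fun y => P.proj y (s₀ y + c)) x v) =
        leftInv (P.frameAt x₀ x) w := by
      rw [← hv]
      exact hprod.symm
    rw [← P.leftInv_frameAt_proj x₀ x] at hv'
    exact hLinj x₀ x hxg _ (P.proj_mem_fibre x _) _ hw hv'

/-- **Transverse sections are dense among the projected translates.**
[cite: HirschDT1976, Ch. 3 §2 Thm. 2.7] -/
theorem dense_setOf_transverse_section (P : ProjBundle n m k M) {s₀ : M → 𝔼 m}
    (hs₀ : ContMDiff (𝓡 n) (𝓡 m) ∞ s₀) :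
    Dense {c : 𝔼 m | ∀ x : M, P.proj x (s₀ x + c) = 0 → ∀ w ∈ P.fibre x, ∃ v : 𝔼 n,
      P.proj x (ediff n m (fun y => P.proj y (s₀ y + c)) x v) = w} := by
  have h := dense_compl_of_volume_eq_zero (P.volume_setOf_not_transverse_section_eq_zero hs₀)
  refine h.mono fun c hc x hx w hw => ?_
  by_contra hbad
  push Not at hbad
  exact hc ⟨x, hx, w, hw, hbad⟩

end ProjBundle

end Literature.Topology.Immersions
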